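import Mathlib.MeasureTheory.Measure.Prod
import Mathlib.MeasureTheory.Constructions.BorelSpace.Basic
import HarnessLib

/-!
# A product measure with a fixed non-zero σ-finite factor determines the other factor
# (Gelbart, *Automorphic forms on adele groups* (1975), Remark 9.23: a Haar measure on `G(𝔸) = G_∞ × G(𝔸_f)` normalised as a product
# `dg = dg_∞ · dg_f` with `dg_f` fixed pins down `dg_∞`)

Topic `MeasureTheory/Measure`; namespace `Literature.MeasureTheory.Measure`.  THEOREMS ONLY.  For measures `μ, μ′` on `α` and a NON-ZERO σ-finite
`ν` on `β`: `μ.prod ν = μ′.prod ν → μ = μ′` (evaluate on rectangles `A × B` with `0 < ν B < ∞`); the same after pushing forward along a measurable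
equivalence `e : α × β ≃ᵐ γ`, and along a continuous group isomorphism `e : A × B ≃* G` of Borel topological spaces (the shape in which the adelic Haar
measure of an anisotropic unitary group is written, `ν_𝔸 = e_* (ν_∞ × ν_f)`, ★ `UnitaryGroup.exists_isHaarMeasure_arch_eq_map_prod_rpMeasure`): with
`ν_f` fixed, `ν_∞` is determined.

## References
* S. Gelbart, *Automorphic forms on adele groups*, Ann. of Math. Stud. 83 (1975), Remark 9.23 [Gelbart1975].
-/

set_option autoImplicit false

noncomputable section

open _root_.MeasureTheory _root_.MeasureTheory.Measure Set

namespace Literature.MeasureTheory.Measure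

variable {α β γ : Type*} [MeasurableSpace α] [MeasurableSpace β] [MeasurableSpace γ]

/-- A non-zero σ-finite measure has a measurable set of finite POSITIVE measure (one of its spanning sets). [cite: Gelbart1975, Remark 9.23] -/
theorem exists_measurableSet_ne_zero_ne_top (ν : Measure β) [SigmaFinite ν] (hν : ν ≠ 0) :
    ∃ B : Set β, MeasurableSet B ∧ ν B ≠ 0 ∧ ν B ≠ ⊤ := by
  by_contra hcon
  apply hν
  rw [← Measure.measure_univ_eq_zero, ← iUnion_spanningSets ν]
  refine measure_iUnion_null fun n => ?_
  by_contra h0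
  exact hcon ⟨_, measurableSet_spanningSets ν n, h0, (measure_spanningSets_lt_top ν n).ne⟩

/-- **Left cancellation of a product measure**: `μ × ν = μ′ × ν` with `ν ≠ 0` σ-finite forces `μ = μ′` (evaluate on `A × B`, `0 < ν B < ∞`).
[cite: Gelbart1975, Remark 9.23] -/
theorem prod_left_cancel {μ μ' : Measure α} {ν : Measure β} [SFinite μ] [SFinite μ'] [SigmaFinite ν] (hν : ν ≠ 0)
    (h : μ.prod ν = μ'.prod ν) : μ = μ' := by
  obtain ⟨B, hB, hB0, hBtop⟩ := exists_measurableSet_ne_zero_ne_top ν hν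
  ext A hA
  have hAB := congrArg (fun ρ : Measure (α × β) => ρ (A ×ˢ B)) h
  simp only [Measure.prod_prod] at hAB
  exact (ENNReal.mul_left_inj hB0 hBtop).mp hAB

/-- The same after a measurable equivalence `e : α × β ≃ᵐ γ`: `e_* (μ × ν) = e_* (μ′ × ν)`, `ν ≠ 0` σ-finite `⇒ μ = μ′`. [cite: Gelbart1975, Remark 9.23] -/
theorem eq_of_map_prod_eq_map_prod (e : α × β ≃ᵐ γ) {μ μ' : Measure α} {ν : Measure β} [SFinite μ] [SFinite μ'] [SigmaFinite ν]
    (hν : ν ≠ 0) (h : Measure.map e (μ.prod ν) = Measure.map e (μ'.prod ν)) : μ = μ' := by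
  have h' := congrArg (Measure.map e.symm) h
  simp only [MeasurableEquiv.map_symm_map] at h'
  exact prod_left_cancel hν h'

/-- The same along a CONTINUOUS GROUP ISOMORPHISM `e : A × B ≃* G` of Borel spaces with continuous inverse (the shape `ν_𝔸 = e_* (ν_∞ × ν_f)` of ★
`UnitaryGroup.exists_isHaarMeasure_arch_eq_map_prod_rpMeasure`): with the finite-adelic factor `ν_f ≠ 0` fixed, the archimedean factor is determined,
`e_* (ν_∞ × ν_f) = e_* (ν′_∞ × ν_f) ⇒ ν_∞ = ν′_∞`. [cite: Gelbart1975, Remark 9.23] -/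
theorem eq_of_map_mulEquiv_prod_eq {A B G : Type*} [TopologicalSpace A] [MeasurableSpace A] [BorelSpace A] [TopologicalSpace B]
    [MeasurableSpace B] [BorelSpace B] [SecondCountableTopologyEither A B] [TopologicalSpace G] [MeasurableSpace G] [BorelSpace G]
    [Mul A] [Mul B] [Mul G] (e : A × B ≃* G) (he : Continuous e) (hes : Continuous e.symm)
    {μ μ' : Measure A} {ν : Measure B} [SFinite μ] [SFinite μ'] [SigmaFinite ν] (hν : ν ≠ 0)
    (h : Measure.map e (μ.prod ν) = Measure.map e (μ'.prod ν)) : μ = μ' := by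
  let E : A × B ≃ₜ G := { e.toEquiv with continuous_toFun := he, continuous_invFun := hes }
  have hE : (E.toMeasurableEquiv : A × B → G) = e := rfl
  refine eq_of_map_prod_eq_map_prod E.toMeasurableEquiv hν ?_
  rw [hE]
  exact h

end Literature.MeasureTheory.Measure
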